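import Summits.BirchSwinnertonDyer.BirchSwinnertonDyer.Theorems.PrintX11aLowerHalfThreePartnerContra
import Summits.BirchSwinnertonDyer.BirchSwinnertonDyer.Theorems.PrintX11aNonSurjMuAnHardFiveIffTwinMuAn
import Summits.BirchSwinnertonDyer.BirchSwinnertonDyer.Theorems.PrintX11aLowerHalfPartnerThree
import Literature.NumberTheory.EllipticCurves.Wuthrich2014.ThreeAdicImageSupersingularProofs
import HarnessLib

/-!
# Crux `X11aLowerHalf` (item stmt-BirchSwinnertonDyer-19064) from the SIX registered stubs of line «birth» r7, with K2's
# item 19948 BY NAME — the W-81′ children glue (lead bsd-line-x11a-p1 gen 2; `--supports stmt-BirchSwinnertonDyer-19064` helper)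

HONEST FRAMING. One composition theorem (two spellings); no definition, no named fact, no `sorry`. CONDITIONAL: every
hypothesis is DISPLAYED — twenty-seven statement-only named published facts (never proved), K2's OPEN item 19948
(`Theses.ErratumRoadFive.NonSurjCornerTwinMuAn`, Greenberg's analytic `μ = 0` on the non-surjective X11a pairs at `p ∈ {5,7}`),
Greenberg's analytic `μ = 0` on the deep SURJECTIVE X11a pairs at `p ≥ 5` (OPEN — LNM 1716 Conj. 1.11 on that locus), the
good-ordinary 3-congruent partner on the finite-flat off-Kodaira deep locus at `3` (per pair a finite certificate; class-wide a
composite argument outside the tree), and the lower half on the très-ramifié off-Kodaira deep locus at `3` (THE OPEN CORE).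
The gate records a `conditional-result`; nothing is closed; BSD is proved for no curve and no class. beyond-print theorem: no.

## What

The line of record «birth» r7 on crux L (`Cruxes/X11aLowerHalf/Lines/birth.lean`, skeleton sha16 9f7978fe, registered
2026-08-28 by this seat) has the registered stubs
`stub_twinMuAn` (= item 19948 BY NAME) | `stub_muAnSurjDeepFive` | `stub_partnerThree` | `stub_lowerTresRamifieThree` |
`stub_printFactsLower` (22 facts) | `stub_partnerFactsLower` (5 facts), and its in-file composition feeds er5-p2 g4's glue
`ThreePartner.x11aLowerHalf_of_printFactsLower_of_partnerFacts_of_muAnFive_of_partner_of_tresRamifie` (p629328) the DERIVED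
both-images certificate `stub_muAnDeepFive_of_r5`.  For the planner's W-81′ booking («children follow the line of record; glue =
the landed composition») the glue must read the CHILD statements themselves.  This file is that glue:

  `x11aLowerHalf_of_children : (22 facts) → (5 facts) → Theses.ErratumRoadFive.NonSurjCornerTwinMuAn → (stub_muAnSurjDeepFive) →
     (stub_partnerThree) → (stub_lowerTresRamifieThree) → Theses.PrintX11a.X11aLowerHalf`

(every hypothesis VERBATIM the registered stub statement; the both-images certificate is assembled inside from 19948 and the
surjective statement by the lead g1's `Theorems.muAnDeepFive_of_nonSurjCornerTwinMuAn_of_surjDeep` (p625247) modulo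
Balakrishnan–Dogra–Müller–Tuitman–Vonk Thm. 1.2 = conjunct 19 of the 22-fact bundle), and the `ErratumRoadFive` spelling
(the two route decls are one statement, `Iff.rfl`).  Closing recipe once the planner files children C₁ … C₅ with these exact
statements (19948 exists): `theorem X11aLowerHalf_holds : Theses.PrintX11a.X11aLowerHalf := x11aLowerHalf_of_children C_facts22
C_facts5 C_19948 C_surj C_partner C_tres` (`--workitem stmt-BirchSwinnertonDyer-19064`).

References: [GreenbergLNM1716] Conj. 1.11; [Wan2015] Thm. 4; [EmertonPollackWeston2006] Thm. 1, Thm. 5.1.3, Cor. 5.1.4;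
[YanZhu2024MainConjNonCM] Thm. 4.9; [BalakrishnanEtAl2019] Thm. 1.2; [Miller2011LMS] Def. 1.1; cell files
`Cruxes/X11aLowerHalf/Lines/birth.lean` (r7), `PICKED.md`, `LEAD-g1-VERDICT.md`.
-/

set_option autoImplicit false
set_option linter.dupNamespace false -- the directory name repeats the summit name (sibling precedent)

noncomputable section

open scoped Classical

open WeierstrassCurve IsDedekindDomain Rat.HeightOneSpectrum
  Literature.NumberTheory.EllipticCurves
  Literature.NumberTheory.EllipticCurves.ModularForms
  Literature.NumberTheory.EllipticCurves.Rank1Residual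
  Literature.NumberTheory.EllipticCurves.Rank1Residual.Typed
  Literature.NumberTheory.EllipticCurves.Wuthrich2014
  Literature.NumberTheory.EllipticCurves.SteinWuthrich2013
  Literature.NumberTheory.EllipticCurves.Greenberg1999
  Literature.NumberTheory.EllipticCurves.Kato2004
  Literature.NumberTheory.EllipticCurves.GreenbergVatsal2000
  Literature.NumberTheory.EllipticCurves.EmertonPollackWeston2006
  Literature.NumberTheory.EllipticCurves.SkinnerUrban2014
  Literature.NumberTheory.EllipticCurves.BalakrishnanEtAl2019
  Summit.BirchSwinnertonDyer.Rank1Residual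

namespace Summit.BirchSwinnertonDyer.BirchSwinnertonDyer.Theorems.Birth

/-- **Crux L BY NAME from the six registered stubs of line «birth» r7, item 19948 BY NAME — the W-81′ children glue**
(CONDITIONAL; the gate records a `conditional-result`; closes nothing).  Hypotheses, each VERBATIM a registered stub statement of
`Cruxes/X11aLowerHalf/Lines/birth.lean` r7: `hP` = `stub_printFactsLower` (twenty-two print-exact named facts), `hQ` =
`stub_partnerFactsLower` (five), `h48` = `stub_twinMuAn` = K2's item 19948 `Theses.ErratumRoadFive.NonSurjCornerTwinMuAn`, `hS` =
`stub_muAnSurjDeepFive` (Greenberg's analytic `μ = 0` on the deep surjective X11a pairs, `p ≥ 5`), `hA` = `stub_partnerThree`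
(good-ordinary 3-congruent partner on the finite-flat off-Kodaira deep locus at 3), `hT` = `stub_lowerTresRamifieThree` (the open
core at 3).  Proof: the both-images certificate at `p ≥ 5` from `h48` + `hS` modulo BDMTV (conjunct 19 of `hP`) by the lead g1's
`muAnDeepFive_of_nonSurjCornerTwinMuAn_of_surjDeep`, then er5-p2 g4's r7 glue.
[cite: GreenbergLNM1716, §1 Conj. 1.11 (p. 61)] [cite: BalakrishnanEtAl2019, §1 Thm. 1.2] [cite: Wan2015, Thm. 4 (pp. 4–5)]
[cite: EmertonPollackWeston2006, Thm. 1, Cor. 5.1.4 (arXiv:math/0404484 pp. 2, 30)] [cite: YanZhu2024MainConjNonCM, Thm. 4.9]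
[cite: Miller2011LMS, Def. 1.1 (arXiv:1010.2431 p. 3)] -/
theorem x11aLowerHalf_of_children
    (hP : exists_isNewformOf ∧
      thm311_cotorsion_weightK_member_ofLevel_odd ∧ thm1_muAlg_of_weightK_member_ofLevel_odd ∧
      Wan2015.thm4_rational_weightK_member_of_bdd_ofLevel_irred ∧
      thm513_transfer_from_weightK_member_of_bdd_ofLevel_odd ∧
      DeligneSerre1974.thm61_exists_adicGaloisRep ∧ Hida2000_thm326_ordinary ∧
      kato_charIdeal_dvd_multiplicative_of_surjective ∧ lemma20_surjective_threeAdic_of_semistable ∧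
      Kato2004.thm12_4 ∧
      Kato2004.exists_multDivisibilityInputs_nonsplit_contra ∧
      Kato2004.exists_multDivisibilityInputs_split_contra ∧
      Kato2004.exists_multDivisibilityInputs_fine_contra ∧
      mazur_not_dvd_maninConstant_of_odd ∧
      thm61_splitMultiplicative ∧ thm61_nonsplitMultiplicative ∧
      rank_eq_analyticRank_of_analyticRank_le_one ∧
      (∀ (W : WeierstrassCurve ℚ) [W.IsElliptic] [W.IsGloballyMinimal] (p : ℕ) [Fact p.Prime],
        p ≠ 2 → greenberg_stevens (W := W) (p := p)) ∧
      thm12_not_le_normalizer_splitCartan ∧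
      ribet1990_levelLowering_gamma0_newform_at_three_additiveDrop ∧
      thm364_rational_weightK_member_of_bdd_ofLevel_ram ∧
      carayolLivne_additivePrime_dvd_level_of_congruent_newform)
    (hQ : cor514_transfer_of_goodOrdinary_odd ∧ YanZhu2026.thm49_charIdeal_eq_padicLFunction ∧
      realPeriodRat_eq_unit_mul_plusPeriod_three ∧ thm1_muAlg_transfer_goodOrdinary_of_mult_odd ∧
      thm1_muAn_transfer_goodOrdinary_of_mult_odd)
    (h48 : Summit.BirchSwinnertonDyer.BirchSwinnertonDyer.Theses.ErratumRoadFive.NonSurjCornerTwinMuAn)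
    (hS : ∀ (W : WeierstrassCurve ℚ) [W.IsElliptic] [W.IsGloballyMinimal] (p : ℕ) [Fact p.Prime],
      ClassX11a W p → 5 ≤ p → Surj W p → ¬ X11a.ShaAnUnit W p → X11a.MuAnZeroAt W p)
    (hA : ∀ (W : WeierstrassCurve ℚ) [W.IsElliptic] [W.IsGloballyMinimal] (p : ℕ) [Fact p.Prime],
      ClassX11a W p → p = 3 → ¬ X11a.ShaAnUnit W p →
      ¬ (Surj W p ∧ ∃ v : HeightOneSpectrum ℤ, W.HasAdditiveReductionAt v ∧
          3 ∣ (W.kodairaSymbolAt v).componentGroupOrder ∧ ¬ natGenerator v ^ 3 ∣ W.conductorNorm ℤ) →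
      p ∣ padicValInt p W.minimalDiscriminantInt →
      ∃ (A : WeierstrassCurve ℚ) (_ : A.IsElliptic) (_ : A.IsGloballyMinimal),
        A.HasGoodReductionAtPrime p ∧ ¬ (p : ℤ) ∣ A.frobeniusTrace p ∧
        ∃ e : geomTorsion W (p : ℤ) ≃+ geomTorsion A (p : ℤ),
          ∀ (σ : Field.absoluteGaloisGroup ℚ) (P : geomTorsion W (p : ℤ)), e (σ • P) = σ • e P)
    (hT : ∀ (W : WeierstrassCurve ℚ) [W.IsElliptic] [W.IsGloballyMinimal] (p : ℕ) [Fact p.Prime],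
      ClassX11a W p → p = 3 → ¬ X11a.ShaAnUnit W p →
      ¬ (Surj W p ∧ ∃ v : HeightOneSpectrum ℤ, W.HasAdditiveReductionAt v ∧
          3 ∣ (W.kodairaSymbolAt v).componentGroupOrder ∧ ¬ natGenerator v ^ 3 ∣ W.conductorNorm ℤ) →
      ¬ p ∣ padicValInt p W.minimalDiscriminantInt → MissingLowerBoundAt W p) :
    Summit.BirchSwinnertonDyer.BirchSwinnertonDyer.Theses.PrintX11a.X11aLowerHalf :=
  ThreePartner.x11aLowerHalf_printX11a_of_printFactsLower_of_partnerFacts_of_muAnFive_of_partner_of_tresRamifie hP hQ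
    (muAnDeepFive_of_nonSurjCornerTwinMuAn_of_surjDeep hP.2.2.2.2.2.2.2.2.2.2.2.2.2.2.2.2.2.2.1 h48 hS) hA hT

/-- The `ErratumRoadFive` spelling of the same children glue (crux L is wanted by both routes under one statement, `Iff.rfl`).
[cite: Miller2011LMS, Def. 1.1 (arXiv:1010.2431 p. 3)] [cite: GreenbergLNM1716, §1 Conj. 1.11 (p. 61)] -/
theorem x11aLowerHalf_erratumRoadFive_of_children
    (hP : exists_isNewformOf ∧
      thm311_cotorsion_weightK_member_ofLevel_odd ∧ thm1_muAlg_of_weightK_member_ofLevel_odd ∧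
      Wan2015.thm4_rational_weightK_member_of_bdd_ofLevel_irred ∧
      thm513_transfer_from_weightK_member_of_bdd_ofLevel_odd ∧
      DeligneSerre1974.thm61_exists_adicGaloisRep ∧ Hida2000_thm326_ordinary ∧
      kato_charIdeal_dvd_multiplicative_of_surjective ∧ lemma20_surjective_threeAdic_of_semistable ∧
      Kato2004.thm12_4 ∧
      Kato2004.exists_multDivisibilityInputs_nonsplit_contra ∧
      Kato2004.exists_multDivisibilityInputs_split_contra ∧
      Kato2004.exists_multDivisibilityInputs_fine_contra ∧
      mazur_not_dvd_maninConstant_of_odd ∧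
      thm61_splitMultiplicative ∧ thm61_nonsplitMultiplicative ∧
      rank_eq_analyticRank_of_analyticRank_le_one ∧
      (∀ (W : WeierstrassCurve ℚ) [W.IsElliptic] [W.IsGloballyMinimal] (p : ℕ) [Fact p.Prime],
        p ≠ 2 → greenberg_stevens (W := W) (p := p)) ∧
      thm12_not_le_normalizer_splitCartan ∧
      ribet1990_levelLowering_gamma0_newform_at_three_additiveDrop ∧
      thm364_rational_weightK_member_of_bdd_ofLevel_ram ∧
      carayolLivne_additivePrime_dvd_level_of_congruent_newform)
    (hQ : cor514_transfer_of_goodOrdinary_odd ∧ YanZhu2026.thm49_charIdeal_eq_padicLFunction ∧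
      realPeriodRat_eq_unit_mul_plusPeriod_three ∧ thm1_muAlg_transfer_goodOrdinary_of_mult_odd ∧
      thm1_muAn_transfer_goodOrdinary_of_mult_odd)
    (h48 : Summit.BirchSwinnertonDyer.BirchSwinnertonDyer.Theses.ErratumRoadFive.NonSurjCornerTwinMuAn)
    (hS : ∀ (W : WeierstrassCurve ℚ) [W.IsElliptic] [W.IsGloballyMinimal] (p : ℕ) [Fact p.Prime],
      ClassX11a W p → 5 ≤ p → Surj W p → ¬ X11a.ShaAnUnit W p → X11a.MuAnZeroAt W p)
    (hA : ∀ (W : WeierstrassCurve ℚ) [W.IsElliptic] [W.IsGloballyMinimal] (p : ℕ) [Fact p.Prime],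
      ClassX11a W p → p = 3 → ¬ X11a.ShaAnUnit W p →
      ¬ (Surj W p ∧ ∃ v : HeightOneSpectrum ℤ, W.HasAdditiveReductionAt v ∧
          3 ∣ (W.kodairaSymbolAt v).componentGroupOrder ∧ ¬ natGenerator v ^ 3 ∣ W.conductorNorm ℤ) →
      p ∣ padicValInt p W.minimalDiscriminantInt →
      ∃ (A : WeierstrassCurve ℚ) (_ : A.IsElliptic) (_ : A.IsGloballyMinimal),
        A.HasGoodReductionAtPrime p ∧ ¬ (p : ℤ) ∣ A.frobeniusTrace p ∧
        ∃ e : geomTorsion W (p : ℤ) ≃+ geomTorsion A (p : ℤ),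
          ∀ (σ : Field.absoluteGaloisGroup ℚ) (P : geomTorsion W (p : ℤ)), e (σ • P) = σ • e P)
    (hT : ∀ (W : WeierstrassCurve ℚ) [W.IsElliptic] [W.IsGloballyMinimal] (p : ℕ) [Fact p.Prime],
      ClassX11a W p → p = 3 → ¬ X11a.ShaAnUnit W p →
      ¬ (Surj W p ∧ ∃ v : HeightOneSpectrum ℤ, W.HasAdditiveReductionAt v ∧
          3 ∣ (W.kodairaSymbolAt v).componentGroupOrder ∧ ¬ natGenerator v ^ 3 ∣ W.conductorNorm ℤ) →
      ¬ p ∣ padicValInt p W.minimalDiscriminantInt → MissingLowerBoundAt W p) :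
    Summit.BirchSwinnertonDyer.BirchSwinnertonDyer.Theses.ErratumRoadFive.X11aLowerHalf :=
  x11aLowerHalf_of_children hP hQ h48 hS hA hT

/-! ## r8 (APPEND, lead gen 2, 2026-08-28T12:2xZ): `stub_partnerThree` DISCHARGED — the FIVE-children glue -/

/-- **Crux L BY NAME from the FIVE registered stubs of line «birth» r8, item 19948 BY NAME — the W-81′ children glue after
`stub_partnerThree` was PROVED** (`Theorems.Birth.stub_partnerThree`, p632020: every multiplicative-at-3 curve with `3 ∣ ord₃ Δ_min`
has a good ORDINARY 3-congruent partner, via route UniversalToricDescent's Hesse-pencil twin).  CONDITIONAL (the gate records a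
`conditional-result`; closes nothing).  Hypotheses, each VERBATIM a registered stub statement of `Cruxes/X11aLowerHalf/Lines/birth.lean`
r8: `hP` = `stub_printFactsLower` (22 print-exact named facts), `hQ` = `stub_partnerFactsLower` (5), `h48` = `stub_twinMuAn` = K2's item
19948, `hS` = `stub_muAnSurjDeepFive` (Greenberg's analytic `μ = 0` on the deep surjective X11a pairs, `p ≥ 5` — OPEN), `hT` =
`stub_lowerTresRamifieThree` (the très-ramifié open core at `3`).  Closing recipe once children C₁ … C₄ are filed with these exact
statements (19948 exists): `theorem X11aLowerHalf_holds : Theses.PrintX11a.X11aLowerHalf := x11aLowerHalf_of_children_r8 C_facts22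
C_facts5 C_19948 C_surj C_tres`. [cite: GreenbergLNM1716, §1 Conj. 1.11 (p. 61)] [cite: Fisher2012Hessian, Thm. 13.2 (n = 3)]
[cite: Wan2015, Thm. 4 (pp. 4–5)] [cite: YanZhu2024MainConjNonCM, Thm. 4.9] [cite: Miller2011LMS, Def. 1.1 (arXiv:1010.2431 p. 3)] -/
theorem x11aLowerHalf_of_children_r8
    (hP : exists_isNewformOf ∧
      thm311_cotorsion_weightK_member_ofLevel_odd ∧ thm1_muAlg_of_weightK_member_ofLevel_odd ∧
      Wan2015.thm4_rational_weightK_member_of_bdd_ofLevel_irred ∧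
      thm513_transfer_from_weightK_member_of_bdd_ofLevel_odd ∧
      DeligneSerre1974.thm61_exists_adicGaloisRep ∧ Hida2000_thm326_ordinary ∧
      kato_charIdeal_dvd_multiplicative_of_surjective ∧ lemma20_surjective_threeAdic_of_semistable ∧
      Kato2004.thm12_4 ∧
      Kato2004.exists_multDivisibilityInputs_nonsplit_contra ∧
      Kato2004.exists_multDivisibilityInputs_split_contra ∧
      Kato2004.exists_multDivisibilityInputs_fine_contra ∧
      mazur_not_dvd_maninConstant_of_odd ∧
      thm61_splitMultiplicative ∧ thm61_nonsplitMultiplicative ∧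
      rank_eq_analyticRank_of_analyticRank_le_one ∧
      (∀ (W : WeierstrassCurve ℚ) [W.IsElliptic] [W.IsGloballyMinimal] (p : ℕ) [Fact p.Prime],
        p ≠ 2 → greenberg_stevens (W := W) (p := p)) ∧
      thm12_not_le_normalizer_splitCartan ∧
      ribet1990_levelLowering_gamma0_newform_at_three_additiveDrop ∧
      thm364_rational_weightK_member_of_bdd_ofLevel_ram ∧
      carayolLivne_additivePrime_dvd_level_of_congruent_newform)
    (hQ : cor514_transfer_of_goodOrdinary_odd ∧ YanZhu2026.thm49_charIdeal_eq_padicLFunction ∧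
      realPeriodRat_eq_unit_mul_plusPeriod_three ∧ thm1_muAlg_transfer_goodOrdinary_of_mult_odd ∧
      thm1_muAn_transfer_goodOrdinary_of_mult_odd)
    (h48 : Summit.BirchSwinnertonDyer.BirchSwinnertonDyer.Theses.ErratumRoadFive.NonSurjCornerTwinMuAn)
    (hS : ∀ (W : WeierstrassCurve ℚ) [W.IsElliptic] [W.IsGloballyMinimal] (p : ℕ) [Fact p.Prime],
      ClassX11a W p → 5 ≤ p → Surj W p → ¬ X11a.ShaAnUnit W p → X11a.MuAnZeroAt W p)
    (hT : ∀ (W : WeierstrassCurve ℚ) [W.IsElliptic] [W.IsGloballyMinimal] (p : ℕ) [Fact p.Prime],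
      ClassX11a W p → p = 3 → ¬ X11a.ShaAnUnit W p →
      ¬ (Surj W p ∧ ∃ v : HeightOneSpectrum ℤ, W.HasAdditiveReductionAt v ∧
          3 ∣ (W.kodairaSymbolAt v).componentGroupOrder ∧ ¬ natGenerator v ^ 3 ∣ W.conductorNorm ℤ) →
      ¬ p ∣ padicValInt p W.minimalDiscriminantInt → MissingLowerBoundAt W p) :
    Summit.BirchSwinnertonDyer.BirchSwinnertonDyer.Theses.PrintX11a.X11aLowerHalf :=
  x11aLowerHalf_of_children hP hQ h48 hS stub_partnerThree hT

/-- The `ErratumRoadFive` spelling of the five-children glue (one statement under two route names, `Iff.rfl`).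
[cite: Miller2011LMS, Def. 1.1 (arXiv:1010.2431 p. 3)] [cite: GreenbergLNM1716, §1 Conj. 1.11 (p. 61)] -/
theorem x11aLowerHalf_erratumRoadFive_of_children_r8
    (hP : exists_isNewformOf ∧
      thm311_cotorsion_weightK_member_ofLevel_odd ∧ thm1_muAlg_of_weightK_member_ofLevel_odd ∧
      Wan2015.thm4_rational_weightK_member_of_bdd_ofLevel_irred ∧
      thm513_transfer_from_weightK_member_of_bdd_ofLevel_odd ∧
      DeligneSerre1974.thm61_exists_adicGaloisRep ∧ Hida2000_thm326_ordinary ∧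
      kato_charIdeal_dvd_multiplicative_of_surjective ∧ lemma20_surjective_threeAdic_of_semistable ∧
      Kato2004.thm12_4 ∧
      Kato2004.exists_multDivisibilityInputs_nonsplit_contra ∧
      Kato2004.exists_multDivisibilityInputs_split_contra ∧
      Kato2004.exists_multDivisibilityInputs_fine_contra ∧
      mazur_not_dvd_maninConstant_of_odd ∧
      thm61_splitMultiplicative ∧ thm61_nonsplitMultiplicative ∧
      rank_eq_analyticRank_of_analyticRank_le_one ∧
      (∀ (W : WeierstrassCurve ℚ) [W.IsElliptic] [W.IsGloballyMinimal] (p : ℕ) [Fact p.Prime],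
        p ≠ 2 → greenberg_stevens (W := W) (p := p)) ∧
      thm12_not_le_normalizer_splitCartan ∧
      ribet1990_levelLowering_gamma0_newform_at_three_additiveDrop ∧
      thm364_rational_weightK_member_of_bdd_ofLevel_ram ∧
      carayolLivne_additivePrime_dvd_level_of_congruent_newform)
    (hQ : cor514_transfer_of_goodOrdinary_odd ∧ YanZhu2026.thm49_charIdeal_eq_padicLFunction ∧
      realPeriodRat_eq_unit_mul_plusPeriod_three ∧ thm1_muAlg_transfer_goodOrdinary_of_mult_odd ∧
      thm1_muAn_transfer_goodOrdinary_of_mult_odd)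
    (h48 : Summit.BirchSwinnertonDyer.BirchSwinnertonDyer.Theses.ErratumRoadFive.NonSurjCornerTwinMuAn)
    (hS : ∀ (W : WeierstrassCurve ℚ) [W.IsElliptic] [W.IsGloballyMinimal] (p : ℕ) [Fact p.Prime],
      ClassX11a W p → 5 ≤ p → Surj W p → ¬ X11a.ShaAnUnit W p → X11a.MuAnZeroAt W p)
    (hT : ∀ (W : WeierstrassCurve ℚ) [W.IsElliptic] [W.IsGloballyMinimal] (p : ℕ) [Fact p.Prime],
      ClassX11a W p → p = 3 → ¬ X11a.ShaAnUnit W p →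
      ¬ (Surj W p ∧ ∃ v : HeightOneSpectrum ℤ, W.HasAdditiveReductionAt v ∧
          3 ∣ (W.kodairaSymbolAt v).componentGroupOrder ∧ ¬ natGenerator v ^ 3 ∣ W.conductorNorm ℤ) →
      ¬ p ∣ padicValInt p W.minimalDiscriminantInt → MissingLowerBoundAt W p) :
    Summit.BirchSwinnertonDyer.BirchSwinnertonDyer.Theses.ErratumRoadFive.X11aLowerHalf :=
  x11aLowerHalf_of_children_r8 hP hQ h48 hS hT

/-! ## r9 (APPEND, lead gen 3, 2026-08-28T12:5xZ): Wuthrich Lemma 20 FED BY THE TREE, the flagged (ram) fact ISOLATED — the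
SIX-children glue (twenty flag-free facts | the (ram) fact | five partner facts | 19948 | surjective μ | très-ramifié core) -/

/-- **r8's twenty-two-fact bundle from r9's two fact children and the tree's proof of Wuthrich 2014 Lemma 20** (pure
reassembly in r8's order; conjunct 9 = `Wuthrich2014.lemma20_surjective_threeAdic_of_semistable_holds`, proved in
`Literature/…/Wuthrich2014/ThreeAdicImageSupersingularProofs.lean` locally at `3`; conjunct 21 = the isolated Skinner–Urban 3.6.4 (ram)
fact).  [cite: Wuthrich2014, Lemma 20 (p. 399)] [cite: SkinnerUrban2014, Thm. 1 (p. 2) = Thm. 3.6.4 (p. 43)] -/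
theorem printFactsLower_of_twentyFacts_of_suRamFact
    (hP20 : exists_isNewformOf ∧
      thm311_cotorsion_weightK_member_ofLevel_odd ∧ thm1_muAlg_of_weightK_member_ofLevel_odd ∧
      Wan2015.thm4_rational_weightK_member_of_bdd_ofLevel_irred ∧
      thm513_transfer_from_weightK_member_of_bdd_ofLevel_odd ∧
      DeligneSerre1974.thm61_exists_adicGaloisRep ∧ Hida2000_thm326_ordinary ∧
      kato_charIdeal_dvd_multiplicative_of_surjective ∧
      Kato2004.thm12_4 ∧
      Kato2004.exists_multDivisibilityInputs_nonsplit_contra ∧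
      Kato2004.exists_multDivisibilityInputs_split_contra ∧
      Kato2004.exists_multDivisibilityInputs_fine_contra ∧
      mazur_not_dvd_maninConstant_of_odd ∧
      thm61_splitMultiplicative ∧ thm61_nonsplitMultiplicative ∧
      rank_eq_analyticRank_of_analyticRank_le_one ∧
      (∀ (W : WeierstrassCurve ℚ) [W.IsElliptic] [W.IsGloballyMinimal] (p : ℕ) [Fact p.Prime],
        p ≠ 2 → greenberg_stevens (W := W) (p := p)) ∧
      thm12_not_le_normalizer_splitCartan ∧
      ribet1990_levelLowering_gamma0_newform_at_three_additiveDrop ∧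
      carayolLivne_additivePrime_dvd_level_of_congruent_newform)
    (hR : thm364_rational_weightK_member_of_bdd_ofLevel_ram) :
    exists_isNewformOf ∧
      thm311_cotorsion_weightK_member_ofLevel_odd ∧ thm1_muAlg_of_weightK_member_ofLevel_odd ∧
      Wan2015.thm4_rational_weightK_member_of_bdd_ofLevel_irred ∧
      thm513_transfer_from_weightK_member_of_bdd_ofLevel_odd ∧
      DeligneSerre1974.thm61_exists_adicGaloisRep ∧ Hida2000_thm326_ordinary ∧
      kato_charIdeal_dvd_multiplicative_of_surjective ∧ lemma20_surjective_threeAdic_of_semistable ∧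
      Kato2004.thm12_4 ∧
      Kato2004.exists_multDivisibilityInputs_nonsplit_contra ∧
      Kato2004.exists_multDivisibilityInputs_split_contra ∧
      Kato2004.exists_multDivisibilityInputs_fine_contra ∧
      mazur_not_dvd_maninConstant_of_odd ∧
      thm61_splitMultiplicative ∧ thm61_nonsplitMultiplicative ∧
      rank_eq_analyticRank_of_analyticRank_le_one ∧
      (∀ (W : WeierstrassCurve ℚ) [W.IsElliptic] [W.IsGloballyMinimal] (p : ℕ) [Fact p.Prime],
        p ≠ 2 → greenberg_stevens (W := W) (p := p)) ∧
      thm12_not_le_normalizer_splitCartan ∧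
      ribet1990_levelLowering_gamma0_newform_at_three_additiveDrop ∧
      thm364_rational_weightK_member_of_bdd_ofLevel_ram ∧
      carayolLivne_additivePrime_dvd_level_of_congruent_newform := by
  obtain ⟨hNf, h311, hT1a, hWan, hT1b, h61, h326, hKato, h12, hns', hsp', hfine', hMz, hJs, hJn, hGZK, hGS, hB, hRb, hCL⟩ := hP20
  exact ⟨hNf, h311, hT1a, hWan, hT1b, h61, h326, hKato, Wuthrich2014.lemma20_surjective_threeAdic_of_semistable_holds,
    h12, hns', hsp', hfine', hMz, hJs, hJn, hGZK, hGS, hB, hRb, hR, hCL⟩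

/-- **Crux L BY NAME from the SIX registered stubs of line «birth» r9, item 19948 BY NAME — the W-81′ children glue after Wuthrich
2014 Lemma 20 was FED BY THE TREE and the flagged Skinner–Urban (ram) fact ISOLATED** (REF g18 R.26 remark C1).  CONDITIONAL (the gate
records a `conditional-result`; closes nothing; BSD is proved for no curve and no class).  Hypotheses, each VERBATIM a registered stub
statement of `Cruxes/X11aLowerHalf/Lines/birth.lean` r9: `hP20` = `stub_twentyFactsLower` (twenty print-exact named facts, no counting
flag), `hR` = `stub_suRamFactLower` (Skinner–Urban 3.6.4 RATIONAL with (ram) at a weight-`k` member — flag `SU14-12.3.6-mu@nonsplit@3`,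
consumed only on the Kodaira sub-locus at 3), `hQ` = `stub_partnerFactsLower` (five), `h48` = `stub_twinMuAn` = K2's item 19948, `hS` =
`stub_muAnSurjDeepFive` (Greenberg's analytic `μ = 0` on the deep surjective X11a pairs, `p ≥ 5` — OPEN), `hT` = `stub_lowerTresRamifieThree`
(the très-ramifié open core at 3).  Closing recipe once children C₁ … C₅ are filed with these exact statements (19948 exists):
`theorem X11aLowerHalf_holds : Theses.PrintX11a.X11aLowerHalf := x11aLowerHalf_of_children_r9 C_facts20 C_ram C_facts5 C_19948 C_surj C_tres`.
[cite: Wuthrich2014, Lemma 20 (p. 399)] [cite: SkinnerUrban2014, Thm. 3.6.4 (p. 43)] [cite: GreenbergLNM1716, §1 Conj. 1.11 (p. 61)]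
[cite: Wan2015, Thm. 4 (pp. 4–5)] [cite: YanZhu2024MainConjNonCM, Thm. 4.9] [cite: Miller2011LMS, Def. 1.1 (arXiv:1010.2431 p. 3)] -/
theorem x11aLowerHalf_of_children_r9
    (hP20 : exists_isNewformOf ∧
      thm311_cotorsion_weightK_member_ofLevel_odd ∧ thm1_muAlg_of_weightK_member_ofLevel_odd ∧
      Wan2015.thm4_rational_weightK_member_of_bdd_ofLevel_irred ∧
      thm513_transfer_from_weightK_member_of_bdd_ofLevel_odd ∧
      DeligneSerre1974.thm61_exists_adicGaloisRep ∧ Hida2000_thm326_ordinary ∧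
      kato_charIdeal_dvd_multiplicative_of_surjective ∧
      Kato2004.thm12_4 ∧
      Kato2004.exists_multDivisibilityInputs_nonsplit_contra ∧
      Kato2004.exists_multDivisibilityInputs_split_contra ∧
      Kato2004.exists_multDivisibilityInputs_fine_contra ∧
      mazur_not_dvd_maninConstant_of_odd ∧
      thm61_splitMultiplicative ∧ thm61_nonsplitMultiplicative ∧
      rank_eq_analyticRank_of_analyticRank_le_one ∧
      (∀ (W : WeierstrassCurve ℚ) [W.IsElliptic] [W.IsGloballyMinimal] (p : ℕ) [Fact p.Prime],
        p ≠ 2 → greenberg_stevens (W := W) (p := p)) ∧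
      thm12_not_le_normalizer_splitCartan ∧
      ribet1990_levelLowering_gamma0_newform_at_three_additiveDrop ∧
      carayolLivne_additivePrime_dvd_level_of_congruent_newform)
    (hR : thm364_rational_weightK_member_of_bdd_ofLevel_ram)
    (hQ : cor514_transfer_of_goodOrdinary_odd ∧ YanZhu2026.thm49_charIdeal_eq_padicLFunction ∧
      realPeriodRat_eq_unit_mul_plusPeriod_three ∧ thm1_muAlg_transfer_goodOrdinary_of_mult_odd ∧
      thm1_muAn_transfer_goodOrdinary_of_mult_odd)
    (h48 : Summit.BirchSwinnertonDyer.BirchSwinnertonDyer.Theses.ErratumRoadFive.NonSurjCornerTwinMuAn)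
    (hS : ∀ (W : WeierstrassCurve ℚ) [W.IsElliptic] [W.IsGloballyMinimal] (p : ℕ) [Fact p.Prime],
      ClassX11a W p → 5 ≤ p → Surj W p → ¬ X11a.ShaAnUnit W p → X11a.MuAnZeroAt W p)
    (hT : ∀ (W : WeierstrassCurve ℚ) [W.IsElliptic] [W.IsGloballyMinimal] (p : ℕ) [Fact p.Prime],
      ClassX11a W p → p = 3 → ¬ X11a.ShaAnUnit W p →
      ¬ (Surj W p ∧ ∃ v : HeightOneSpectrum ℤ, W.HasAdditiveReductionAt v ∧
          3 ∣ (W.kodairaSymbolAt v).componentGroupOrder ∧ ¬ natGenerator v ^ 3 ∣ W.conductorNorm ℤ) →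
      ¬ p ∣ padicValInt p W.minimalDiscriminantInt → MissingLowerBoundAt W p) :
    Summit.BirchSwinnertonDyer.BirchSwinnertonDyer.Theses.PrintX11a.X11aLowerHalf :=
  x11aLowerHalf_of_children_r8 (printFactsLower_of_twentyFacts_of_suRamFact hP20 hR) hQ h48 hS hT

/-- The `ErratumRoadFive` spelling of the six-children glue r9 (one statement under two route names, `Iff.rfl`).
[cite: Miller2011LMS, Def. 1.1 (arXiv:1010.2431 p. 3)] [cite: Wuthrich2014, Lemma 20 (p. 399)] -/
theorem x11aLowerHalf_erratumRoadFive_of_children_r9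
    (hP20 : exists_isNewformOf ∧
      thm311_cotorsion_weightK_member_ofLevel_odd ∧ thm1_muAlg_of_weightK_member_ofLevel_odd ∧
      Wan2015.thm4_rational_weightK_member_of_bdd_ofLevel_irred ∧
      thm513_transfer_from_weightK_member_of_bdd_ofLevel_odd ∧
      DeligneSerre1974.thm61_exists_adicGaloisRep ∧ Hida2000_thm326_ordinary ∧
      kato_charIdeal_dvd_multiplicative_of_surjective ∧
      Kato2004.thm12_4 ∧
      Kato2004.exists_multDivisibilityInputs_nonsplit_contra ∧
      Kato2004.exists_multDivisibilityInputs_split_contra ∧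
      Kato2004.exists_multDivisibilityInputs_fine_contra ∧
      mazur_not_dvd_maninConstant_of_odd ∧
      thm61_splitMultiplicative ∧ thm61_nonsplitMultiplicative ∧
      rank_eq_analyticRank_of_analyticRank_le_one ∧
      (∀ (W : WeierstrassCurve ℚ) [W.IsElliptic] [W.IsGloballyMinimal] (p : ℕ) [Fact p.Prime],
        p ≠ 2 → greenberg_stevens (W := W) (p := p)) ∧
      thm12_not_le_normalizer_splitCartan ∧
      ribet1990_levelLowering_gamma0_newform_at_three_additiveDrop ∧
      carayolLivne_additivePrime_dvd_level_of_congruent_newform)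
    (hR : thm364_rational_weightK_member_of_bdd_ofLevel_ram)
    (hQ : cor514_transfer_of_goodOrdinary_odd ∧ YanZhu2026.thm49_charIdeal_eq_padicLFunction ∧
      realPeriodRat_eq_unit_mul_plusPeriod_three ∧ thm1_muAlg_transfer_goodOrdinary_of_mult_odd ∧
      thm1_muAn_transfer_goodOrdinary_of_mult_odd)
    (h48 : Summit.BirchSwinnertonDyer.BirchSwinnertonDyer.Theses.ErratumRoadFive.NonSurjCornerTwinMuAn)
    (hS : ∀ (W : WeierstrassCurve ℚ) [W.IsElliptic] [W.IsGloballyMinimal] (p : ℕ) [Fact p.Prime],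
      ClassX11a W p → 5 ≤ p → Surj W p → ¬ X11a.ShaAnUnit W p → X11a.MuAnZeroAt W p)
    (hT : ∀ (W : WeierstrassCurve ℚ) [W.IsElliptic] [W.IsGloballyMinimal] (p : ℕ) [Fact p.Prime],
      ClassX11a W p → p = 3 → ¬ X11a.ShaAnUnit W p →
      ¬ (Surj W p ∧ ∃ v : HeightOneSpectrum ℤ, W.HasAdditiveReductionAt v ∧
          3 ∣ (W.kodairaSymbolAt v).componentGroupOrder ∧ ¬ natGenerator v ^ 3 ∣ W.conductorNorm ℤ) →
      ¬ p ∣ padicValInt p W.minimalDiscriminantInt → MissingLowerBoundAt W p) :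
    Summit.BirchSwinnertonDyer.BirchSwinnertonDyer.Theses.ErratumRoadFive.X11aLowerHalf :=
  x11aLowerHalf_of_children_r9 hP20 hR hQ h48 hS hT

end Summit.BirchSwinnertonDyer.BirchSwinnertonDyer.Theorems.Birth

end
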